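import Literature.Probability.RandomPlanarGeometry.HexSAWLemma2
import HarnessLib

/-!
# The surface-weighted arch cut `A_{T+1,L}(x_c, y) − A_{T,L}(x_c) ≤ x_c · B_{T+1,L}(x_c, y) · B_T(x_c)`
# (face Y2′ of the door «HEX-YC-DCS»: BBdGDCG 2014, §4.5)

Topic `Literature/Probability/RandomPlanarGeometry` (continues `HexSAWLowerBound.lean` — the Duminil-Copin–Smirnov
strip domains `S_{T,L}` = `HV.stripV T L`, mid-edge walks `HV.midWalks`, classes `IsAlphaDart`/`IsBetaDart`/`IsEpsDart`,
partition functions `HV.stripA/stripB/stripE`, bridges `HV.bridgeLists` with `HV.stripB_eq_sum_bridgeLists`, the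
FIRST-visit cutting map `HV.cutDom/cutFst/cutSnd` behind DCS eq. (6) `HV.stripA_succ_le`, and `HV.stripBlim`; and
`HexSAWLemma2.lean` — Lemma 2 discharged, hence `stripB_le_lim : B_{T,L} ≤ B_T`).  Source: N. R. Beaton,
M. Bousquet-Mélou, J. de Gier, H. Duminil-Copin, A. J. Guttmann, *The critical fugacity for surface adsorption of
self-avoiding walks on the honeycomb lattice is `1 + √2`*, Comm. Math. Phys. 326 (2014) 727–754, arXiv:1109.0358v5,
§4.5 eq. (20) p. 15: "By looking at its last contact, one can factor the arch into two bridges …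
`A_{T+1}(x_c, y) − A_T(x_c, 1) ≤ x_c B_T(x_c, 1) B_{T+1}(x_c, y)`" — with `A_{T,L}(x,y)`, `B_{T,L}(x,y)` the class
generating functions of §2 eq. (2) / §3.3 carrying the surface weight `y^{c(γ)}`, `c(γ)` = number of visited vertices
on the top level ("contacts with the surface", §2 p. 5 and proof of Proposition 4 p. 7).

## What is proved (lane «pcv-sawmu», door «HEX-YC-DCS» of a-idea-1 gen 17, ROUTES-G17 §1, face Y2′ `StripArchCut`)

* `HV.surfContacts T P`, `HV.stripGFy T L cls y` — the surface-weighted class generating functions at `x = x_c`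
  (a-idea-1's typed vocabulary, verbatim); `stripGFy_beta_eq_sum_bridgeLists` (`B_{T,L}(x_c,y)` as a sum over
  bridges), `stripGFy_alpha_of_inner_subset` bookkeeping;
* the LAST-contact cutting map on `HV.cutDom T L` (the arches of `S_{T+1,L}` leaving `S_{T,L}`): `lcIdx`, `lcFst`
  (the arch up to its last surface contact `v`, a bridge of `S_{T+1,L}` carrying all the contacts), `lcSnd` (the
  arch after the vertex `u` below `v`, reversed and re-based at `a`: a bridge of `S_{T,2L}`), `lcFst_mem`, `lcSnd_mem`,
  `lc_injOn` ("uniquely": `u` is the down-neighbour of `v` other than the predecessor of `v`), `length_eq_lc`;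
* **`HV.stripGFy_alpha_succ_le`** — the FINITE form of (20):
  `A_{T+1,L}(x_c,y) ≤ A_{T,L}(x_c) + x_c · B_{T+1,L}(x_c,y) · B_{T,2L}(x_c)`, and
  **`HV.stripArchCut`** — `A_{T+1,L}(x_c,y) − A_{T,L}(x_c) ≤ x_c · B_{T+1,L}(x_c,y) · B_T(x_c)` for all `T ≥ 1`, `L`,
  `y > 0` (a-idea-1's face `StripArchCut`, Sketch_G17 l. 405, closed by name: `stripArchCut_holds`).
-/

noncomputable section

open Finset Literature.Probability.LatticeModels Literature.Probability.Percolation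

namespace Literature.Probability.RandomPlanarGeometry.SAW.HV

/-! ### Surface contacts and the `y`-weighted class generating functions -/

/-- Surface contacts in the DCS strip `S_{T,L}`: visited vertices on the top level `2T − 1` (the vertices under a `β`
mid-edge). [cite: BeatonBousquetMelouDeGierDuminilCopinGuttmann2014, §2 (arXiv v5 p. 5: "c(γ) the number of contacts with the surface") and proof of Proposition 4 (p. 7)] -/
def surfContacts (T : ℕ) (P : List HV) : ℕ := ((inner P).filter fun v => lev v = 2 * (T : ℤ) - 1).length

/-- `y`-weighted class generating function of `S_{T,L}` at `x = x_c`: `Σ_{γ : finalDart ∈ cls} x_c^{|γ|} y^{c(γ)}`.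
[cite: BeatonBousquetMelouDeGierDuminilCopinGuttmann2014, §2 eq. (2) and §3.3 (A_{T,L}, B_{T,L}, E_{T,L} with argument y)] -/
def stripGFy (T L : ℕ) (cls : HV × HV → Prop) [DecidablePred cls] (y : ℝ) : ℝ :=
  ∑ P ∈ (midWalks (stripV T L)).filter (fun P => cls (finalDart P)), hexCriticalFugacity ^ mwLen P * y ^ surfContacts T P

/-- Consistency with the tree's `stripB` at `y = 1`. [cite: BeatonBousquetMelouDeGierDuminilCopinGuttmann2014, §3.3] -/
theorem stripGFy_beta_one (T L : ℕ) : stripGFy T L (IsBetaDart T) 1 = stripB T L hexCriticalFugacity := by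
  simp [stripGFy, stripB]

/-- Consistency with the tree's `stripA` at `y = 1`. [cite: BeatonBousquetMelouDeGierDuminilCopinGuttmann2014, §3.3] -/
theorem stripGFy_alpha_one (T L : ℕ) : stripGFy T L IsAlphaDart 1 = stripA T L hexCriticalFugacity := by
  simp [stripGFy, stripA]

/-- The contacts of `w :: (l ++ [u])` are those of its inner list `l`. [cite: BeatonBousquetMelouDeGierDuminilCopinGuttmann2014, §2] -/
theorem surfContacts_cons_append (T : ℕ) (l : List HV) (u : HV) :
    surfContacts T (wOut :: (l ++ [u])) = (l.filter fun v => lev v = 2 * (T : ℤ) - 1).length := by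
  rw [surfContacts, inner_cons_append]

/-- `B_{T,L}(x_c, y) = Σ_{bridges l of S_{T,L}} x_c^{|l|} y^{#contacts(l)}`.
[cite: BeatonBousquetMelouDeGierDuminilCopinGuttmann2014, §3.3 (B_{T,L}(x,y))] -/
theorem stripGFy_beta_eq_sum_bridgeLists {T L : ℕ} (hT : 1 ≤ T) (y : ℝ) :
    stripGFy T L (IsBetaDart T) y =
      ∑ l ∈ bridgeLists T L, hexCriticalFugacity ^ l.length * y ^ (l.filter fun v => lev v = 2 * (T : ℤ) - 1).length := by
  rw [stripGFy, bridgeLists, sum_image]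
  · refine sum_congr rfl fun P hP => ?_
    rw [mem_filter, mem_midWalks_iff] at hP
    rw [hP.1.length_inner, surfContacts]
  · intro P hP P' hP' h
    rw [mem_coe, mem_filter, mem_midWalks_iff] at hP hP'
    obtain ⟨l, hl, rfl, -⟩ := eq_of_isBetaDart hT hP.1 hP.2
    obtain ⟨l', hl', rfl, -⟩ := eq_of_isBetaDart hT hP'.1 hP'.2
    simp only [inner_cons_append] at h
    subst h; rfl

/-- An arch of `S_{T+1,L}` staying inside `S_{T,L}` has no surface contact (its vertices have level `≤ 2T − 1`).
[cite: BeatonBousquetMelouDeGierDuminilCopinGuttmann2014, §4.5] -/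
theorem surfContacts_eq_zero_of_inner_subset {T L : ℕ} {P : List HV} (h : ∀ x ∈ inner P, x ∈ stripV T L) :
    surfContacts (T + 1) P = 0 := by
  rw [surfContacts, List.length_eq_zero_iff, List.filter_eq_nil_iff]
  intro v hv hlev
  have := (lev_mem_of_mem_stripV (h v hv)).2
  simp only [decide_eq_true_eq] at hlev
  push_cast at hlev
  omega

/-! ### The last surface contact of an arch of `cutDom T L` -/

section LastCut

variable {T L : ℕ}

/-- The indices of the surface contacts (level `2T + 1`) of an inner list in `S_{T+1}`.
[cite: BeatonBousquetMelouDeGierDuminilCopinGuttmann2014, §4.5] -/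
def contactIdxs (T : ℕ) (l : List HV) : Finset ℕ :=
  (Finset.range l.length).filter fun i => lev (l.getD i hvOrigin) = 2 * (T : ℤ) + 1

/-- The index of the LAST surface contact ("by looking at its last contact"); `0` if there is none.
[cite: BeatonBousquetMelouDeGierDuminilCopinGuttmann2014, §4.5 (arXiv v5 p. 15)] -/
def lcIdx (T : ℕ) (l : List HV) : ℕ :=
  if h : (contactIdxs T l).Nonempty then (contactIdxs T l).max' h else 0

/-- Membership in `contactIdxs`. [cite: BeatonBousquetMelouDeGierDuminilCopinGuttmann2014, §4.5] -/
theorem mem_contactIdxs {l : List HV} {i : ℕ} :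
    i ∈ contactIdxs T l ↔ ∃ h : i < l.length, lev l[i] = 2 * (T : ℤ) + 1 := by
  rw [contactIdxs, mem_filter, mem_range]
  constructor
  · rintro ⟨hi, hl⟩
    refine ⟨hi, ?_⟩
    rwa [List.getD_eq_getElem?_getD, List.getElem?_eq_getElem hi, Option.getD_some] at hl
  · rintro ⟨hi, hl⟩
    refine ⟨hi, ?_⟩
    rwa [List.getD_eq_getElem?_getD, List.getElem?_eq_getElem hi, Option.getD_some]

/-- If some vertex of `l` is a contact, `lcIdx` is a contact index and every later index is not.
[cite: BeatonBousquetMelouDeGierDuminilCopinGuttmann2014, §4.5] -/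
theorem lcIdx_spec {l : List HV} {i₀ : ℕ} (hi₀ : i₀ < l.length) (hlev : lev l[i₀] = 2 * (T : ℤ) + 1) :
    (∃ h : lcIdx T l < l.length, lev l[lcIdx T l] = 2 * (T : ℤ) + 1) ∧
      ∀ i (hi : i < l.length), lcIdx T l < i → lev l[i] ≠ 2 * (T : ℤ) + 1 := by
  have hne : (contactIdxs T l).Nonempty := ⟨i₀, mem_contactIdxs.2 ⟨hi₀, hlev⟩⟩
  have hj : lcIdx T l = (contactIdxs T l).max' hne := by rw [lcIdx, dif_pos hne]
  refine ⟨?_, fun i hi hlt heq => ?_⟩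
  · have := Finset.max'_mem _ hne
    rw [← hj] at this
    exact mem_contactIdxs.1 this
  · have := Finset.le_max' (contactIdxs T l) i (mem_contactIdxs.2 ⟨hi, heq⟩)
    rw [← hj] at this
    omega

set_option maxHeartbeats 400000 in
/-- Anatomy of an arch of `A_{T+1,L} ∖ A_{T,L}` around its LAST contact `v = l[j]` (`j = lcIdx`): `j ≥ 1`;
`l[j+1] = u` has level `2T` and is, together with `l[j-1]`, one of the two down-neighbours of `v`, `u ≠ l[j-1]`;
`l[j+2]` exists and every `l[i]`, `i ≥ j + 2`, has level `≤ 2T − 1` (after its last contact the arch steps down to `u`,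
whose only other neighbours are contacts, so it steps down again and can never come back to level `2T`).
[cite: BeatonBousquetMelouDeGierDuminilCopinGuttmann2014, §4.5 (arXiv v5 p. 15, the last-contact factorisation)] -/
theorem lastCut_spec (hT : 1 ≤ T) {P : List HV} (hP : P ∈ cutDom T L) :
    ∃ (l : List HV) (hl : l ≠ []),
      P = wOut :: (l ++ [((l.getLast hl).1, -1, true)]) ∧ l.IsChain hvGraph.Adj ∧
      l.head? = some hvOrigin ∧ l.Nodup ∧ (∀ x ∈ l, x ∈ stripV (T + 1) L) ∧
      (l.getLast hl).2.1 = 0 ∧ (l.getLast hl).2.2 = false ∧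
      ∃ (hj : lcIdx T l + 2 < l.length),
        1 ≤ lcIdx T l ∧
        lev l[lcIdx T l] = 2 * (T : ℤ) + 1 ∧
        (∀ i (hi : i < l.length), lcIdx T l < i → lev l[i] ≠ 2 * (T : ℤ) + 1) ∧
        (l[lcIdx T l]).2.2 = true ∧ (l[lcIdx T l]).2.1 = (T : ℤ) ∧
        lev l[lcIdx T l + 1] = 2 * (T : ℤ) ∧
        (l[lcIdx T l + 1] = ((l[lcIdx T l]).1, (T : ℤ), false) ∨
          l[lcIdx T l + 1] = ((l[lcIdx T l]).1 + 1, (T : ℤ), false)) ∧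
        (l[lcIdx T l - 1] = ((l[lcIdx T l]).1, (T : ℤ), false) ∨
          l[lcIdx T l - 1] = ((l[lcIdx T l]).1 + 1, (T : ℤ), false)) ∧
        l[lcIdx T l + 1] ≠ l[lcIdx T l - 1] ∧
        l[lcIdx T l + 2] = ((l[lcIdx T l + 1]).1, (T : ℤ) - 1, true) ∧
        ∀ i (hi : i < l.length), lcIdx T l + 2 ≤ i → lev l[i] ≤ 2 * (T : ℤ) - 1 := by
  obtain ⟨l, hl, hP, hc, hh, hnd, hV, h0, hf, hidx, hlev0⟩ := cutDom_spec hT hP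
  obtain ⟨⟨hj, hlevj⟩, hafter⟩ := lcIdx_spec (T := T) hidx (hlev0 hidx)
  have hlast : lev (l.getLast hl) = 0 := by simp [lev, bit, h0, hf]
  have hlevV : ∀ i (hi : i < l.length), 0 ≤ lev l[i] ∧ lev l[i] ≤ 2 * (T : ℤ) + 1 := fun i hi => by
    have := lev_mem_of_mem_stripV (hV _ (List.getElem_mem hi)); push_cast at this; omega
  -- `l = O :: l'`
  obtain ⟨l', rfl⟩ : ∃ l', l = hvOrigin :: l' := by
    cases l with
    | nil => exact absurd rfl hl
    | cons a l => exact ⟨l, by simp only [List.head?_cons, Option.some.injEq] at hh; rw [hh]⟩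
  -- `lcIdx ≥ 1`: `l[0] = O` has level `0`
  have hj1 : 1 ≤ lcIdx T (hvOrigin :: l') := by
    by_contra h0'
    have hj0 : lcIdx T (hvOrigin :: l') = 0 := by omega
    have e : lev ((hvOrigin :: l')[lcIdx T (hvOrigin :: l')]'hj) = lev hvOrigin := by simp [hj0]
    rw [e] at hlevj
    simp [hvOrigin, lev, bit] at hlevj
    omega
  -- `lcIdx` is not the last index (the last vertex has level `0`)
  have hjl : lcIdx T (hvOrigin :: l') + 1 < (hvOrigin :: l').length := by
    by_contra hcon
    have : lcIdx T (hvOrigin :: l') = (hvOrigin :: l').length - 1 := by omega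
    have e : (hvOrigin :: l')[lcIdx T (hvOrigin :: l')] = (hvOrigin :: l').getLast hl := by
      simp only [this, List.getLast_eq_getElem]
    rw [e, hlast] at hlevj; omega
  -- type and coordinates of `v = l[j]`
  have hvt : ((hvOrigin :: l')[lcIdx T (hvOrigin :: l')]).2.2 = true := by
    rcases hvj : (hvOrigin :: l')[lcIdx T (hvOrigin :: l')] with ⟨a, b, c⟩
    rw [hvj] at hlevj
    cases c
    · simp [lev, bit] at hlevj; omega
    · rfl
  have hvx : ((hvOrigin :: l')[lcIdx T (hvOrigin :: l')]).2.1 = (T : ℤ) := by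
    rcases hvj : (hvOrigin :: l')[lcIdx T (hvOrigin :: l')] with ⟨a, b, c⟩
    rw [hvj] at hlevj hvt
    simp only at hvt
    subst hvt
    simp [lev, bit] at hlevj
    omega
  -- `u = l[j+1]`: adjacent to `v`, in the strip, hence a down-neighbour
  have hadj1 := hc.getElem (lcIdx T (hvOrigin :: l')) hjl
  have hu_lev : lev (hvOrigin :: l')[lcIdx T (hvOrigin :: l') + 1] = 2 * (T : ℤ) := by
    rcases lev_eq_of_adj hadj1 with h | h
    · have := (hlevV (lcIdx T (hvOrigin :: l') + 1) hjl).2; omega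
    · omega
  have hdown : ∀ w : HV, hvGraph.Adj (hvOrigin :: l')[lcIdx T (hvOrigin :: l')] w → lev w = 2 * (T : ℤ) →
      w = (((hvOrigin :: l')[lcIdx T (hvOrigin :: l')]).1, (T : ℤ), false) ∨
        w = (((hvOrigin :: l')[lcIdx T (hvOrigin :: l')]).1 + 1, (T : ℤ), false) := by
    intro w hw hlw
    rcases hvj : (hvOrigin :: l')[lcIdx T (hvOrigin :: l')] with ⟨a, b, c⟩
    rw [hvj] at hw hvt hvx
    rcases w with ⟨a', b', c'⟩
    simp only at hvt hvx
    subst hvt; subst hvx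
    cases c' <;> simp [hvGraph_adj, AdjRel, lev, bit] at hw hlw ⊢; omega
  have hu := hdown _ hadj1 hu_lev
  -- the predecessor `l[j-1]`
  have hadj0 := hc.getElem (lcIdx T (hvOrigin :: l') - 1) (by omega)
  have e01 : lcIdx T (hvOrigin :: l') - 1 + 1 = lcIdx T (hvOrigin :: l') := by omega
  simp only [e01] at hadj0
  have hp_lev : lev (hvOrigin :: l')[lcIdx T (hvOrigin :: l') - 1] = 2 * (T : ℤ) := by
    rcases lev_eq_of_adj hadj0.symm with h | h
    · have := (hlevV (lcIdx T (hvOrigin :: l') - 1) (by omega)).2; omega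
    · omega
  have hp := hdown _ hadj0.symm hp_lev
  have hne : (hvOrigin :: l')[lcIdx T (hvOrigin :: l') + 1] ≠ (hvOrigin :: l')[lcIdx T (hvOrigin :: l') - 1] := by
    intro h
    have := (List.Nodup.getElem_inj_iff hnd).1 h
    omega
  -- `u` is not the last vertex (level `2T ≠ 0`)
  have hj2 : lcIdx T (hvOrigin :: l') + 2 < (hvOrigin :: l').length := by
    by_contra hcon
    have : lcIdx T (hvOrigin :: l') + 1 = (hvOrigin :: l').length - 1 := by omega
    have e : (hvOrigin :: l')[lcIdx T (hvOrigin :: l') + 1] = (hvOrigin :: l').getLast hl := by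
      simp only [this, List.getLast_eq_getElem]
    rw [e, hlast] at hu_lev; omega
  -- after `u`: levels `≤ 2T - 1`
  have hut : ((hvOrigin :: l')[lcIdx T (hvOrigin :: l') + 1]).2.2 = false := by
    rcases hu with h | h <;> rw [h]
  have htail : ∀ i (hi : i < (hvOrigin :: l').length), lcIdx T (hvOrigin :: l') + 2 ≤ i →
      lev (hvOrigin :: l')[i] ≤ 2 * (T : ℤ) - 1 := by
    intro i hi hji
    by_contra hgt
    have hli : lev (hvOrigin :: l')[i] = 2 * (T : ℤ) := by
      have h1 := (hlevV i hi).2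
      have h2 := hafter i hi (by omega)
      omega
    have hti : ((hvOrigin :: l')[i]).2.2 = false := by
      rcases hvi : (hvOrigin :: l')[i] with ⟨a, b, c⟩
      rw [hvi] at hli
      cases c
      · rfl
      · simp [lev, bit] at hli; omega
    -- `l[i]` is not the last vertex
    have hil : i + 1 < (hvOrigin :: l').length := by
      by_contra hcon
      have : i = (hvOrigin :: l').length - 1 := by omega
      have e : (hvOrigin :: l')[i] = (hvOrigin :: l').getLast hl := by simp only [this, List.getLast_eq_getElem]
      rw [e, hlast] at hli; omega
    have h1 := hc.getElem (i - 1) (by omega)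
    have h2 := hc.getElem i hil
    have ei : i - 1 + 1 = i := by omega
    simp only [ei] at h1
    have hn1 : lev (hvOrigin :: l')[i - 1] = 2 * (T : ℤ) - 1 := by
      rcases lev_eq_of_adj h1.symm with h | h
      · have := hafter (i - 1) (by omega) (by omega); omega
      · omega
    have hn2 : lev (hvOrigin :: l')[i + 1] = 2 * (T : ℤ) - 1 := by
      rcases lev_eq_of_adj h2 with h | h
      · have := hafter (i + 1) hil (by omega); omega
      · omega
    have e1 := eq_of_adj_of_lev_lt hti h1.symm (by omega)
    have e2 := eq_of_adj_of_lev_lt hti h2 (by omega)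
    have := (List.Nodup.getElem_inj_iff hnd).1 (e1.trans e2.symm)
    omega
  -- `w₁ = l[j+2]` is the vertex below `u`
  have hw : (hvOrigin :: l')[lcIdx T (hvOrigin :: l') + 2] =
      (((hvOrigin :: l')[lcIdx T (hvOrigin :: l') + 1]).1, (T : ℤ) - 1, true) := by
    have h2 : hvGraph.Adj (hvOrigin :: l')[lcIdx T (hvOrigin :: l') + 1] (hvOrigin :: l')[lcIdx T (hvOrigin :: l') + 2] :=
      hc.getElem (lcIdx T (hvOrigin :: l') + 1) hj2
    have e := eq_of_adj_of_lev_lt hut h2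
      (by have := htail (lcIdx T (hvOrigin :: l') + 2) hj2 le_rfl; omega)
    rw [e]
    rcases hu with h | h <;> simp [h]
  exact ⟨hvOrigin :: l', hl, hP, hc, hh, hnd, hV, h0, hf, hj2, hj1, hlevj, hafter, hvt, hvx, hu_lev, hu, hp, hne,
    hw, htail⟩

/-! ### The last-contact cutting map -/

/-- The first piece: the arch up to its last contact `[O, …, v]` (a bridge of `S_{T+1,L}` carrying every contact).
[cite: BeatonBousquetMelouDeGierDuminilCopinGuttmann2014, §4.5 (arXiv v5 p. 15)] -/
def lcFst (T : ℕ) (l : List HV) : List HV := l.take (lcIdx T l + 1)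

/-- The reversed tail `[l.last, …, l[j+2]]` (from the exit back up to the vertex below `u`), before translation.
[cite: BeatonBousquetMelouDeGierDuminilCopinGuttmann2014, §4.5] -/
def lcRev (T : ℕ) (l : List HV) : List HV := (l.drop (lcIdx T l + 2)).reverse

/-- The second piece: the reversed tail translated horizontally so that it starts at `O` (a bridge of `S_{T,2L}`).
[cite: BeatonBousquetMelouDeGierDuminilCopinGuttmann2014, §4.5] -/
def lcSnd (T : ℕ) (l : List HV) : List HV :=
  (lcRev T l).map (shift (-((lcRev T l).headD hvOrigin).1) 0)

/-- The first piece is a bridge of `S_{T+1,L}` with the same contacts as the arch.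
[cite: BeatonBousquetMelouDeGierDuminilCopinGuttmann2014, §4.5] -/
theorem lcFst_mem (hT : 1 ≤ T) {P : List HV} (hP : P ∈ cutDom T L) :
    lcFst T (inner P) ∈ bridgeLists (T + 1) L ∧
      ((lcFst T (inner P)).filter fun v => lev v = 2 * ((T + 1 : ℕ) : ℤ) - 1).length =
        ((inner P).filter fun v => lev v = 2 * ((T + 1 : ℕ) : ℤ) - 1).length := by
  obtain ⟨l, hl, rfl, hc, hh, hnd, hV, -, -, hj2, -, hlevj, hafter, -⟩ := lastCut_spec hT hP
  rw [inner_cons_append]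
  have hne : l.take (lcIdx T l + 1) ≠ [] := by simp [hl]
  refine ⟨?_, ?_⟩
  · rw [mem_bridgeLists_iff (by omega), lcFst]
    refine ⟨hc.take _, by rw [List.head?_take]; simpa using hh, hnd.sublist (List.take_sublist _ _),
      fun x hx => hV x (List.mem_of_mem_take hx), hne, ?_⟩
    have hlt : (l.take (lcIdx T l + 1)).getLast hne = l[lcIdx T l] := by
      simp [List.getLast_eq_getElem, List.getElem_take, Nat.min_eq_left (show lcIdx T l + 1 ≤ l.length by omega)]
    rw [hlt]
    push_cast
    linarith [hlevj]
  · -- no contact after the last one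
    conv_rhs => rw [← List.take_append_drop (lcIdx T l + 1) l]
    rw [lcFst, List.filter_append, List.length_append]
    suffices h : ((l.drop (lcIdx T l + 1)).filter fun v => lev v = 2 * ((T + 1 : ℕ) : ℤ) - 1) = [] by
      rw [h, List.length_nil, add_zero]
    rw [List.filter_eq_nil_iff]
    intro v hv
    obtain ⟨k, hk, rfl⟩ := List.mem_iff_getElem.1 hv
    rw [List.getElem_drop]
    rw [List.length_drop] at hk
    have := hafter (lcIdx T l + 1 + k) (by omega) (by omega)
    simp only [decide_eq_true_eq]
    push_cast
    omega

/-- The reversed tail: non-empty, from `l.last` back to `l[j+2]`.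
[cite: BeatonBousquetMelouDeGierDuminilCopinGuttmann2014, §4.5] -/
theorem lcRev_spec (hT : 1 ≤ T) {P : List HV} (hP : P ∈ cutDom T L) :
    ∃ (l : List HV) (hl : l ≠ []) (hr : lcRev T l ≠ []) (hj : lcIdx T l + 2 < l.length), inner P = l ∧
      (lcRev T l).head hr = l.getLast hl ∧ (lcRev T l).getLast hr = l[lcIdx T l + 2] := by
  obtain ⟨l, hl, rfl, -, -, -, -, -, -, hj2, -⟩ := lastCut_spec hT hP
  have hr : lcRev T l ≠ [] := by simp [lcRev]; omega
  refine ⟨l, hl, hr, hj2, inner_cons_append _ _, ?_, ?_⟩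
  · simp [lcRev]
  · simp [lcRev]

/-- The second piece is a bridge of `S_{T,2L}`. [cite: BeatonBousquetMelouDeGierDuminilCopinGuttmann2014, §4.5] -/
theorem lcSnd_mem (hT : 1 ≤ T) {P : List HV} (hP : P ∈ cutDom T L) :
    lcSnd T (inner P) ∈ bridgeLists T (2 * L) := by
  obtain ⟨l, hl, hr, hj2, hin, hhead, hlast⟩ := lcRev_spec hT hP
  obtain ⟨l', hl', hP', hc, hh, hnd, hV, h0, hf, hj2', -, -, -, -, -, hu_lev, -, -, -, hw, htail⟩ :=
    lastCut_spec hT hP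
  obtain rfl : l = l' := by rw [← hin, hP', inner_cons_append]
  rw [hin, lcSnd, mem_bridgeLists_iff hT]
  set a := ((lcRev T l).headD hvOrigin).1 with ha
  have ha' : a = (l.getLast hl).1 := by
    rw [ha, List.headD_eq_head?_getD, List.head?_eq_some_head hr, Option.getD_some, hhead]
  have hzV := hV _ (List.getLast_mem hl)
  rw [mem_stripV_iff] at hzV
  have habs : -(L : ℤ) ≤ a ∧ a ≤ L := by
    rw [ha']; simp only [h0, bit, hf] at hzV; constructor <;> simp at hzV <;> omega
  refine ⟨?_, ?_, ?_, ?_, by simpa using hr, ?_⟩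
  · -- chain
    rw [List.isChain_map]
    have h1 : (lcRev T l).IsChain (fun x y => hvGraph.Adj x y) := by
      rw [lcRev, List.isChain_reverse]
      exact (hc.drop _).imp fun x y (h : hvGraph.Adj x y) => h.symm
    exact h1.imp fun x y h => (shift (-a) 0).map_rel_iff.2 h
  · -- head
    rw [List.head?_map, List.head?_eq_some_head hr, hhead, Option.map_some, shift_apply]
    simp only [Option.some.injEq, hvOrigin, ha', h0, hf, add_zero]
    simp
  · -- nodup
    exact (List.nodup_reverse.2 (hnd.sublist (List.drop_sublist _ _))).map (shift (-a) 0).injective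
  · -- inside `S_{T,2L}`: levels `≤ 2T - 1` after the last contact, lateral shift by at most `L`
    intro y hy
    rw [List.mem_map] at hy
    obtain ⟨v, hv, rfl⟩ := hy
    have hv' : v ∈ l.drop (lcIdx T l + 2) := by rwa [lcRev, List.mem_reverse] at hv
    obtain ⟨k, hk, rfl⟩ := List.mem_iff_getElem.1 hv'
    rw [List.length_drop] at hk
    have hlevk := htail (lcIdx T l + 2 + k) (by omega) (by omega)
    have hmem := hV _ (List.getElem_mem (l := l) (n := lcIdx T l + 2 + k) (by omega))
    rw [List.getElem_drop]
    rw [mem_stripV_iff] at hmem ⊢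
    rcases hvk : l[lcIdx T l + 2 + k] with ⟨p, q, b⟩
    rw [hvk] at hmem hlevk
    cases b <;> simp [bit, lev] at hmem hlevk ⊢ <;> omega
  · -- last vertex on the top level `2T - 1` of `S_T`
    rw [List.getLast_map, hlast, lev_shift_zero, hw]
    simp [lev, bit]
    ring

/-- **Length bookkeeping**: `|l| = |lcFst| + 1 + |lcSnd|` (the vertex `u` below the last contact is in neither piece).
[cite: BeatonBousquetMelouDeGierDuminilCopinGuttmann2014, §4.5 (the factor x_c)] -/
theorem length_eq_lc (hT : 1 ≤ T) {P : List HV} (hP : P ∈ cutDom T L) :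
    mwLen P = (lcFst T (inner P)).length + 1 + (lcSnd T (inner P)).length := by
  obtain ⟨l, hl, hP', -, -, -, -, -, -, hj2, -⟩ := lastCut_spec hT hP
  rw [hP', mwLen_cons_append, inner_cons_append, lcFst, lcSnd, List.length_map, lcRev, List.length_reverse,
    List.length_take, List.length_drop, Nat.min_eq_left (by omega)]
  omega
set_option maxHeartbeats 400000 in
/-- **Injectivity of the last-contact cut** ("uniquely"): the first piece determines `v` and its predecessor, hence
`u` (the OTHER down-neighbour of `v`), hence the translation of the second piece.
[cite: BeatonBousquetMelouDeGierDuminilCopinGuttmann2014, §4.5 (arXiv v5 p. 15)] -/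
theorem lc_injOn (hT : 1 ≤ T) :
    Set.InjOn (fun P => (lcFst T (inner P), lcSnd T (inner P))) (cutDom T L : Set (List HV)) := by
  intro P hP P' hP' h
  simp only [Prod.mk.injEq] at h
  obtain ⟨h1, h2⟩ := h
  obtain ⟨l, hl, hr, hj2, hin, -, hlast⟩ := lcRev_spec hT hP
  obtain ⟨l₀, hl₀, hPeq, -, -, hnd, -, -, -, hjx, hj1, -, -, -, -, -, hu, hp, hne, hw, -⟩ := lastCut_spec hT hP
  obtain rfl : l = l₀ := by rw [← hin, hPeq, inner_cons_append]
  obtain ⟨l', hl', hr', hj2', hin', -, hlast'⟩ := lcRev_spec hT hP'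
  obtain ⟨l₀', hl₀', hPeq', -, -, hnd', -, -, -, hjx', hj1', -, -, -, -, -, hu', hp', hne', hw', -⟩ := lastCut_spec hT hP'
  obtain rfl : l' = l₀' := by rw [← hin', hPeq', inner_cons_append]
  rw [hin, hin'] at h1 h2
  suffices hll : l = l' by subst hll; exact hPeq.trans hPeq'.symm
  rw [lcFst, lcFst] at h1
  have hjj : lcIdx T l = lcIdx T l' := by
    have := congrArg List.length h1
    simp only [List.length_take] at this
    omega
  -- `v` and its predecessor agree (read off the first pieces, in `getElem?` form)
  have hget : ∀ i, i ≤ lcIdx T l → l[i]? = l'[i]? := by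
    intro i hi
    have e1 : (l.take (lcIdx T l + 1))[i]? = l[i]? := List.getElem?_take_of_lt (by omega)
    have e2 : (l'.take (lcIdx T l' + 1))[i]? = l'[i]? := List.getElem?_take_of_lt (by omega)
    rw [h1] at e1
    exact e1.symm.trans e2
  have hv : l[lcIdx T l] = l'[lcIdx T l'] := by
    have e := hget (lcIdx T l) le_rfl
    have e' : l'[lcIdx T l]? = l'[lcIdx T l']? := by rw [hjj]
    rw [e', List.getElem?_eq_getElem (by omega), List.getElem?_eq_getElem (by omega), Option.some_inj] at e
    exact e
  have hpred : l[lcIdx T l - 1] = l'[lcIdx T l' - 1] := by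
    have e := hget (lcIdx T l - 1) (by omega)
    have e' : l'[lcIdx T l - 1]? = l'[lcIdx T l' - 1]? := by rw [hjj]
    rw [e', List.getElem?_eq_getElem (by omega), List.getElem?_eq_getElem (by omega), Option.some_inj] at e
    exact e
  -- hence `u` agrees: it is the other down-neighbour of `v`
  have huu : l[lcIdx T l + 1] = l'[lcIdx T l' + 1] := by
    rw [hv] at hu hp
    rcases hu with h | h <;> rcases hu' with h' | h' <;> rcases hp with q | q <;> rcases hp' with q' | q'
    all_goals first
      | exact h.trans h'.symm
      | exact absurd (h.trans q.symm) hne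
      | exact absurd (h'.trans q'.symm) hne'
      | (exfalso; have e := congrArg Prod.fst ((q.symm.trans hpred).trans q'); simp at e)
  -- hence `w₁` agrees and the translations agree
  have hww : l[lcIdx T l + 2] = l'[lcIdx T l' + 2] := by rw [hw, hw', huu]
  have ha : ((lcRev T l).headD hvOrigin).1 = ((lcRev T l').headD hvOrigin).1 := by
    have := congrArg List.getLast? h2
    rw [lcSnd, lcSnd, List.getLast?_map, List.getLast?_map, List.getLast?_eq_some_getLast hr,
      List.getLast?_eq_some_getLast hr', Option.map_some, Option.map_some, Option.some_inj,
      hlast, hlast', hww] at this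
    have := congrArg Prod.fst this
    simp only [shift_apply] at this
    linarith
  rw [lcSnd, lcSnd, ha] at h2
  have h3 : lcRev T l = lcRev T l' := (List.map_injective_iff.2 (RelIso.injective _)) h2
  rw [lcRev, lcRev, List.reverse_inj] at h3
  calc l = l.take (lcIdx T l + 1) ++ (l[lcIdx T l + 1] :: l.drop (lcIdx T l + 2)) := by
        rw [show lcIdx T l + 2 = lcIdx T l + 1 + 1 from rfl, List.cons_getElem_drop_succ, List.take_append_drop]
    _ = l'.take (lcIdx T l' + 1) ++ (l'[lcIdx T l' + 1] :: l'.drop (lcIdx T l' + 2)) := by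
        rw [h1, huu, h3]
    _ = l' := by
        rw [show lcIdx T l' + 2 = lcIdx T l' + 1 + 1 from rfl, List.cons_getElem_drop_succ, List.take_append_drop]

end LastCut

/-! ### The surface-weighted arch cut -/

/-- **The finite arch cut** (BBdGDCG (20), finite form): for `T ≥ 1`, `L`, `y ≥ 0`,
`A_{T+1,L}(x_c, y) ≤ A_{T,L}(x_c) + x_c · B_{T+1,L}(x_c, y) · B_{T,2L}(x_c)` — contact-free arches of `S_{T+1,L}` are the
arches of `S_{T,L}`; an arch with contacts is cut at its last contact into a bridge of `S_{T+1,L}` carrying all its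
contacts, the vertex below, and (reversed, re-based) a bridge of `S_{T,2L}`, injectively.
[cite: BeatonBousquetMelouDeGierDuminilCopinGuttmann2014, §4.5 eq. (20) (arXiv v5 p. 15)] -/
theorem stripGFy_alpha_succ_le {T : ℕ} (hT : 1 ≤ T) (L : ℕ) {y : ℝ} (hy : 0 ≤ y) :
    stripGFy (T + 1) L IsAlphaDart y ≤
      stripA T L hexCriticalFugacity +
        hexCriticalFugacity * stripGFy (T + 1) L (IsBetaDart (T + 1)) y * stripB T (2 * L) hexCriticalFugacity := by
  have hx : 0 < hexCriticalFugacity := hexCriticalFugacity_pos_lt_one.1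
  -- split the arches of `S_{T+1,L}` into those staying in `S_{T,L}` (no contact) and `cutDom`
  have hsplit : stripGFy (T + 1) L IsAlphaDart y =
      stripA T L hexCriticalFugacity + ∑ P ∈ cutDom T L, hexCriticalFugacity ^ mwLen P * y ^ surfContacts (T + 1) P := by
    rw [stripGFy, stripA, cutDom, ← Finset.sum_filter_add_sum_filter_not
      ((midWalks (stripV (T + 1) L)).filter fun P => IsAlphaDart (finalDart P))
      (fun P => ∀ x ∈ inner P, x ∈ stripV T L)]
    congr 1
    rw [midWalks_stripV_eq_filter T L, Finset.filter_filter, Finset.filter_filter]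
    rw [Finset.sum_congr (Finset.filter_congr fun P _ => and_comm) fun P hP => ?_]
    rw [mem_filter] at hP
    rw [surfContacts_eq_zero_of_inner_subset hP.2.1, pow_zero, mul_one]
  rw [hsplit, add_le_add_iff_left]
  -- the weight of a cut arch
  have hw : ∀ P ∈ cutDom T L, hexCriticalFugacity ^ mwLen P * y ^ surfContacts (T + 1) P =
      hexCriticalFugacity *
        ((hexCriticalFugacity ^ (lcFst T (inner P)).length *
            y ^ ((lcFst T (inner P)).filter fun v => lev v = 2 * ((T + 1 : ℕ) : ℤ) - 1).length) *
          hexCriticalFugacity ^ (lcSnd T (inner P)).length) := by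
    intro P hP
    obtain ⟨-, hcnt⟩ := lcFst_mem hT hP
    rw [length_eq_lc hT hP, hcnt, surfContacts]
    ring
  rw [Finset.sum_congr rfl hw, ← Finset.mul_sum, stripGFy_beta_eq_sum_bridgeLists (by omega),
    stripB_eq_sum_bridgeLists hT, mul_assoc, Finset.sum_mul_sum, ← Finset.sum_product']
  refine mul_le_mul_of_nonneg_left ?_ hx.le
  exact sum_le_sum_of_injOn_of_nonneg (fun P => (lcFst T (inner P), lcSnd T (inner P)))
    (lc_injOn hT) (fun P hP => Finset.mem_product.2 ⟨(lcFst_mem hT hP).1, lcSnd_mem hT hP⟩)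
    (fun p => hexCriticalFugacity ^ p.1.length *
        y ^ (p.1.filter fun v => lev v = 2 * ((T + 1 : ℕ) : ℤ) - 1).length * hexCriticalFugacity ^ p.2.length)
    fun _ _ => by positivity

/-- **Face Y2′ «STRIP-ARCH-CUT» of the door «HEX-YC-DCS»**: for `T ≥ 1`, every `L` and `y > 0`,
`A_{T+1,L}(x_c, y) − A_{T,L}(x_c) ≤ x_c · B_{T+1,L}(x_c, y) · B_T(x_c)` (with `B_T = sup_L B_{T,L}(x_c)`, tree `HV.stripBlim`).
[cite: BeatonBousquetMelouDeGierDuminilCopinGuttmann2014, §4.5 eq. (20) (arXiv v5 p. 15: "A_{T+1}(x_c,y) − A_T(x_c,1) ≤ x_c B_T(x_c,1) B_{T+1}(x_c,y)")] -/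
theorem stripArchCut {T : ℕ} (hT : 1 ≤ T) (L : ℕ) {y : ℝ} (hy : 0 < y) :
    stripGFy (T + 1) L IsAlphaDart y - stripA T L hexCriticalFugacity ≤
      hexCriticalFugacity * stripGFy (T + 1) L (IsBetaDart (T + 1)) y * stripBlim T := by
  have hx : 0 < hexCriticalFugacity := hexCriticalFugacity_pos_lt_one.1
  have h := stripGFy_alpha_succ_le hT L hy.le
  have hB : stripB T (2 * L) hexCriticalFugacity ≤ stripBlim T :=
    stripB_le_lim DuminilCopinSmirnov2012_lemma2_holds hT (2 * L)
  have hBy : 0 ≤ stripGFy (T + 1) L (IsBetaDart (T + 1)) y :=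
    sum_nonneg fun P _ => by positivity
  have := mul_le_mul_of_nonneg_left hB (mul_nonneg hx.le hBy)
  linarith

/-- a-idea-1 gen 17's face `StripArchCut` (Sketch_G17 l. 405, verbatim over this file's `stripGFy`).
[cite: BeatonBousquetMelouDeGierDuminilCopinGuttmann2014, §4.5 eq. (20)] -/
def StripArchCut : Prop :=
  ∀ (T L : ℕ) (y : ℝ), 1 ≤ T → 0 < y →
    stripGFy (T + 1) L IsAlphaDart y - stripA T L hexCriticalFugacity ≤
      hexCriticalFugacity * stripGFy (T + 1) L (IsBetaDart (T + 1)) y * stripBlim T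

/-- Y2′ holds. [cite: BeatonBousquetMelouDeGierDuminilCopinGuttmann2014, §4.5 eq. (20)] -/
theorem stripArchCut_holds : StripArchCut := fun _ L _ hT hy => stripArchCut hT L hy

end Literature.Probability.RandomPlanarGeometry.SAW.HV
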